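import Literature.Analysis.FluidPDE.TsaiTopSingularNullHolds
import Literature.Analysis.FluidPDE.LocalTypeI
import HarnessLib

/-!
# The top singular set of an extinct Type-I apex is `ℋ¹`-null
# (item `TerminalTrace.TypeITraceScarL3`, stmt-NavierStokesRegularity-18385; nsreg-p2 g28 working line (ii)/(iv))

Seat ns-typeII-p3 g9 (cell ns-regularity-ideate), `--supports stmt-NavierStokesRegularity-18385` (helper).
The apex package of line `apex-dichotomy` begins with «`(U, P)` is a suitable weak solution in every
parabolic ball `Q(a)` at the space–time origin» (`IsSuitableWeakSolutionInBall`, Albritton–Barker's class: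
suitable on the open cylinder, `L^∞_t L²_x` energy bound, weak gradient with `∇U ∈ L²`,
`P ∈ L^{3/2}`).  These four clauses are literally the hypotheses of Tsai 1998, Lemma 4.2 and the remark
following it — Caffarelli–Kohn–Nirenberg's Theorem B AT THE TOP of the cylinder — PROVED in the tree
(`tsai1998_top_singular_null_holds`).  Hence:

* `hausdorffMeasure_topSingular_inBall_eq_zero` — for a suitable weak solution in the parabolic ball
  `Q_ρ(T, x₀)` (A–B class), the set of `x ∈ B(x₀, ρ)` with `(T, x)` backward singular is `μH[1]`-null;
* `hausdorffMeasure_topSingular_apex_eq_zero` — for an apex package (suitable in every `Q(a)`), the whole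
  top singular set `Σ₀(U) = {x | (0, x) backward singular}` is `μH[1]`-null («extinct Type-I DUST»:
  whatever a SPREAD apex carries to spatial infinity as `s → 0⁻`, its trace on the top slice is an
  `ℋ¹`-null closed set — the measure-theoretic input of the planner's STRONG EXTINCTION step).

WHAT THIS IS NOT: not Stub C, not NS regularity — CKN/Tsai bookkeeping for the apex class.
[cite: Tsai1998, remark after Lemma 4.2 (p. 46); CaffarelliKohnNirenberg1982, Theorem B]
-/

noncomputable section

set_option linter.dupNamespace false

namespace Summit.NavierStokesRegularity.NavierStokesRegularity.Theorems.TypeITraceScarL3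

open MeasureTheory Set Function Filter Topology Metric
open Literature.Analysis.FluidPDE
open scoped NNReal ENNReal

/-- **CKN's Theorem B at the top of a parabolic ball, Albritton–Barker class.**  If `(u, p)` is a suitable
weak solution in the parabolic ball `Q_ρ(T, x₀)` in the sense of `IsSuitableWeakSolutionInBall` (the four
clauses: suitable on the open cylinder, energy bound, weak gradient in `L²`, pressure in `L^{3/2}`), then
`μH[1] {x ∈ B(x₀, ρ) | (T, x) is backward singular} = 0` (the tree's `tsai1998_top_singular_null_holds`,
with the clauses re-spelled). [cite: Tsai1998, remark after Lemma 4.2 (p. 46)] -/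
theorem hausdorffMeasure_topSingular_inBall_eq_zero
    {ρ T : ℝ} {x₀ : EuclideanSpace ℝ (Fin 3)} (hρ : 0 < ρ)
    {u : ℝ → EuclideanSpace ℝ (Fin 3) → EuclideanSpace ℝ (Fin 3)}
    {p : ℝ → EuclideanSpace ℝ (Fin 3) → ℝ}
    (h : IsSuitableWeakSolutionInBall ρ (T, x₀) u p) :
    μH[1] {x ∈ ball x₀ ρ | IsBackwardSingularPoint u (T, x)} = 0 := by
  obtain ⟨hsw, ⟨C, hC⟩, hgrad, hp⟩ := h
  -- the energy clause, in Tsai's spelling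
  have henergy : ∃ C : ℝ≥0, ∀ᵐ t : ℝ, t ∈ Ioo (T - ρ ^ 2) T →
      ∫⁻ x in ball x₀ ρ, ‖u t x‖ₑ ^ 2 ≤ C :=
    ⟨C, (ae_restrict_iff' measurableSet_Ioo).1 hC⟩
  -- the pressure clause, in Tsai's spelling
  have hp' : ∫⁻ z in parabolicCylinder ρ (T, x₀), ‖p z.1 z.2‖ₑ ^ (3 / 2 : ℝ) < ∞ := by
    have h32ne : (3 / 2 : ℝ≥0∞) ≠ ∞ :=
      ENNReal.div_ne_top (by norm_num) (by norm_num)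
    have h1 := lintegral_rpow_enorm_lt_top_of_eLpNorm_lt_top (by norm_num) h32ne
      hp.eLpNorm_lt_top
    have h32 : ((3 / 2 : ℝ≥0∞)).toReal = (3 / 2 : ℝ) := by norm_num
    rw [h32] at h1
    exact h1
  exact tsai1998_top_singular_null_holds one_pos hρ hsw henergy hgrad hp'

/-- **The top singular set of an extinct Type-I apex is `ℋ¹`-null.**  If `(U, P)` is a suitable weak
solution in every parabolic ball `Q(a)` at the space–time origin (the first clause of the apex package
of line `apex-dichotomy`), then `μH[1] {x | (0, x) is a backward-singular point of U} = 0`: cover `ℝ³`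
by the balls `B(0, n+1)` and apply CKN's Theorem B at the top of `Q(n+1)`
(`hausdorffMeasure_topSingular_inBall_eq_zero`). [cite: Tsai1998, remark after Lemma 4.2 (p. 46)] -/
theorem hausdorffMeasure_topSingular_apex_eq_zero
    {U : ℝ → EuclideanSpace ℝ (Fin 3) → EuclideanSpace ℝ (Fin 3)}
    {P : ℝ → EuclideanSpace ℝ (Fin 3) → ℝ}
    (hsw : ∀ a : ℝ, 0 < a →
      IsSuitableWeakSolutionInBall a (0 : ℝ × EuclideanSpace ℝ (Fin 3)) U P) :
    μH[1] {x : EuclideanSpace ℝ (Fin 3) |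
      IsBackwardSingularPoint U ((0 : ℝ), x)} = 0 := by
  have hcov : {x : EuclideanSpace ℝ (Fin 3) | IsBackwardSingularPoint U ((0 : ℝ), x)} ⊆
      ⋃ n : ℕ, {x ∈ ball (0 : EuclideanSpace ℝ (Fin 3)) ((n : ℝ) + 1) |
        IsBackwardSingularPoint U ((0 : ℝ), x)} := by
    intro x hx
    obtain ⟨n, hn⟩ := exists_nat_gt ‖x‖
    refine mem_iUnion.2 ⟨n, ⟨?_, hx⟩⟩
    rw [mem_ball_zero_iff]; linarith
  refine measure_mono_null hcov (measure_iUnion_null fun n => ?_)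
  have hn : (0 : ℝ) < n + 1 := by positivity
  have h := hausdorffMeasure_topSingular_inBall_eq_zero hn (hsw _ hn)
  simpa using h

end Summit.NavierStokesRegularity.NavierStokesRegularity.Theorems.TypeITraceScarL3

end
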